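import Summits.CriticalPhenomena.PercolationContinuityZ3.Theorems.PercNearOneGluingNoHeavyLowerTailSahiGridPatternIndepSlots
import Summits.CriticalPhenomena.PercolationContinuityZ3.Theorems.PercNearOneGluingNoHeavyLowerTailSahiGridPatternBlockProduct

/-!
# `NoHeavyLowerTail` (crux stmt-CriticalPhenomena-4575), Sahi programme P1: **THE ZERO LOCUS OF THE PATTERN FUNCTIONAL —
# an independent pair and a third set saturated along their blocks make `sStarD` VANISH IDENTICALLY, every dimension**

Support file (Sahi cell, seat `prim-sahi-p1`, generation 14; `--supports stmt-CriticalPhenomena-4575`).  Pure proofs, no definitions, no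
`sorry`, standard axioms.  Vocabulary of `…SahiGridPattern{,SliceForm,Harris,Kleitman,TwoLayerTop,IndepSlots,BlockProduct}` (`Pd`, `sStarD`,
`ind`, `TotDist`, `thirdPt`, the counting form `sStarD_counting`, `mixThird_invol`, `mix_mix`, `sum_ite_totDist_eq_two_pow`).

THE MATHEMATICS.  `P_d = [3]^d`; `N(X;Y,Z) = #{(p,q) : p ∈ X, q ∈ Y ∩ Z, p, q differ in every axis}`, `L(X;Y,Z) = #` Latin triples in `X × Y × Z`,
`D = |X ∩ Y ∩ Z|`, and (`sStarD_counting`) `sStarD X Y Z = 2^{d+1} D − N(X;Y,Z) − N(Y;X,Z) − N(Z;X,Y) + L(X;Y,Z)`.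

**THEOREM (`sStarD_eq_zero_of_indepSlots_saturated`, every `d`, NO monotonicity needed).**  Let `I, J ⊆ [d]` be disjoint sets of axes and
`A, B, C ⊆ P_d` ARBITRARY subsets such that membership in `A` depends only on the coordinates in `I`, membership in `B` only on the coordinates
in `J`, and membership in `C` does not change (a) when the `I`-coordinates of a point of `B` are altered, (b) when the `J`-coordinates of a
point of `A` are altered (for up-sets with `A, B ≠ ∅` this says: every nonempty section of `C` along the remaining axes contains `A ∪ B`).
Then `sStarD A B C = 0`.
PROOF — three explicit involutions of `P_d × P_d`, each matching one negative count with one positive count term by term: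
* `N(C;A,B) = L(A;B,C)` (`sum_td_meet_eq_latin`): `(z, y) ↦ (b, z)` with `b := (thirdPt y z on I, y off I)` — the re-pairing bijection of
  `…IndepSlots` (`mixThird_invol`), which under (block-)measurability of `A` and `B` is value-preserving, not merely an injection;
* `N(A;B,C) = 2^d·D` (`sum_td_meet_eq_pow_mul_diag`): `(p, q) ↦ ((p on I, q off I), (q on I, p off I))` — the coordinate swap on the block `I`
  (`mix_mix` of `…BlockProduct`); it sends a totally distinct pair `(p, q)`, `p ∈ A`, `q ∈ B ∩ C`, to a totally distinct pair `(q', p')` with `q' ∈ A ∩ B ∩ C`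
  (hypothesis (a) moves `C`-membership from `q` to `q'`), and there are `2^d` partners `p'` per point `q'` (`sum_ite_totDist_eq_two_pow`);
* `N(B;A,C) = 2^d·D`: the same with the block `J` and hypothesis (b).
Summing the counting form gives `0`.  ∎
COROLLARIES (every `d`): `sStarD A B C = 0` when `A` is `I`-measurable, `B` is `J`-measurable (`I ∩ J = ∅`) and EITHER `C` is measurable with respect
to the axes outside `I ∪ J` (three mutually independent slots, `sStarD_eq_zero_of_threeIndep`) OR `A ∪ B ⊆ C` (`sStarD_eq_zero_of_indep_union_subset`,
the 'coefficientwise zero' family of the census) OR `C = X ∩ (A ∪ B)` with `X` measurable outside `I ∪ J` (the GATE family, `sStarD_eq_zero_of_gate`).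
So on these families Sahi's cubic `Z³E₃` of a `d`-dimensional product grid has NO Latin (all-values-distinct) coefficient at all.
CENSUS (this generation, exact, seat code `code/classify_zeros.py`, `code/c/pp_zeros3.c`): on the Boolean shadow (three-partition functional
`N(𝒰,𝒱,𝒲)`, `…ShadowTPP`) the hypothesis of the theorem describes EVERY zero with three nonempty proper up-families at `m = 4` (all `4 704` ordered zero
triples) and every sampled zero at `m = 5, 6` (`6 542 + 654`); on `[3]^3` it explains `2 687` of the `2 822` zero triples (`i ≤ j ≤ k`, no empty/full
slot), the remaining `135` using the level structure of `[3]` (e.g. `A = ↑{022,102}`, `B = ↑{200}`, `C = ↑{022,120}`: `B` reads only the threshold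
`x₁ = 2`, `A, C` only `x₁ ≥ 1`).  CONJECTURE (zero locus, Boolean shadow): these are all the zeros.  HONEST LABEL: identities only; `PatternPos d`
(`d ≥ 5`), Sahi's `C₃` and Kahn's conjecture remain OPEN; nothing here asserts them. [this work]
-/

namespace Summit.CriticalPhenomena.PercolationContinuityZ3.Theorems.SahiGridPattern

open Finset
open SahiGrid3 (ind)
open scoped BigOperators

variable {d : ℕ}

/-! ### Small tools -/

/-- Indicators agree at two points with equivalent membership. [this work] -/
theorem ind_congr_mem {Y : Type*} [DecidableEq Y] {S : Finset Y} {x y : Y} (h : x ∈ S ↔ y ∈ S) : ind S x = ind S y := by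
  unfold ind
  by_cases hx : x ∈ S
  · rw [if_pos hx, if_pos (h.1 hx)]
  · rw [if_neg hx, if_neg (fun hy => hx (h.2 hy))]

/-- In `[3]`: if the third value of `(u, v)` differs from `v` then `u ≠ v`. [this work] -/
theorem ne_of_neg_add_ne : ∀ u v : Fin 3, -(u + v) ≠ v → u ≠ v := by decide

/-- `TotDist` is decided by the family of coordinatewise disequalities. [this work] -/
theorem totDist_congr {p q p' q' : Pd d} (h : (∀ a, p a ≠ q a) ↔ (∀ a, p' a ≠ q' a)) : TotDist p q = TotDist p' q' := by
  rw [Bool.eq_iff_iff, totDist_iff, totDist_iff]; exact h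

/-! ### First involution: totally distinct pairs `(z, y)`, `z ∈ C`, `y ∈ A ∩ B`, versus Latin triples in `A × B × C` -/

/-- **`N(C;A,B) = L(A;B,C)`** (every `d`, no monotonicity): if membership in `A` depends only on the axes in `I` and membership in `B` only on the
axes outside `I`, the number of totally distinct pairs `(z, y)` with `z ∈ C`, `y ∈ A ∩ B` EQUALS the number of Latin triples in `A × B × C`
(the re-pairing bijection of `…IndepSlots` is value-preserving under block measurability). [this work] -/
theorem sum_td_meet_eq_latin (I : Finset (Fin d)) {A B : Finset (Pd d)} (C : Finset (Pd d))
    (hA : ∀ x y : Pd d, (∀ a ∈ I, x a = y a) → (x ∈ A ↔ y ∈ A))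
    (hB : ∀ x y : Pd d, (∀ a ∉ I, x a = y a) → (x ∈ B ↔ y ∈ B)) :
    (∑ p, ∑ q, ind C p * ind A q * ind B q * (if TotDist p q = true then (1:ℤ) else 0)) =
      ∑ q, ∑ r, ind B q * ind C r * ind A (thirdPt q r) * (if TotDist q r = true then (1:ℤ) else 0) := by
  classical
  let ψ : Pd d → Pd d → Pd d := fun q p a => if a ∈ I then thirdPt q p a else q a
  have hψ : ∀ q p : Pd d, ψ (ψ q p) p = q := fun q p => mixThird_invol I q p
  let e : Pd d × Pd d ≃ Pd d × Pd d :=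
    { toFun := fun x => (ψ x.2 x.1, x.1)
      invFun := fun x => (x.2, ψ x.1 x.2)
      left_inv := fun x => Prod.ext rfl (hψ x.2 x.1)
      right_inv := fun x => Prod.ext (hψ x.1 x.2) rfl }
  have memB : ∀ p q : Pd d, q ∈ B ↔ ψ q p ∈ B := fun p q =>
    (hB (ψ q p) q fun a ha => by show (if a ∈ I then thirdPt q p a else q a) = q a; rw [if_neg ha]).symm
  have memA : ∀ p q : Pd d, q ∈ A ↔ thirdPt (ψ q p) p ∈ A := fun p q =>
    (hA (thirdPt (ψ q p) p) q fun a ha => by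
      show -((if a ∈ I then thirdPt q p a else q a) + p a) = q a
      rw [if_pos ha]
      exact neg_neg_add_add (q a) (p a)).symm
  have tdψ : ∀ p q : Pd d, TotDist p q = TotDist (ψ q p) p := by
    intro p q
    apply totDist_congr
    constructor
    · intro h a
      by_cases ha : a ∈ I
      · show (if a ∈ I then thirdPt q p a else q a) ≠ p a
        rw [if_pos ha]
        exact neg_add_ne_of_ne (q a) (p a) (fun e => h a e.symm)
      · show (if a ∈ I then thirdPt q p a else q a) ≠ p a
        rw [if_neg ha]
        exact fun e => h a e.symm
    · intro h a
      have h1 : (if a ∈ I then thirdPt q p a else q a) ≠ p a := h a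
      by_cases ha : a ∈ I
      · rw [if_pos ha] at h1
        exact fun e => ne_of_neg_add_ne (q a) (p a) h1 e.symm
      · rw [if_neg ha] at h1
        exact fun e => h1 e.symm
  have pt : ∀ p q : Pd d, ind C p * ind A q * ind B q * (if TotDist p q = true then (1:ℤ) else 0) =
      ind B (ψ q p) * ind C p * ind A (thirdPt (ψ q p) p) * (if TotDist (ψ q p) p = true then (1:ℤ) else 0) := by
    intro p q
    rw [ind_congr_mem (memA p q), ind_congr_mem (memB p q), tdψ p q]; ring
  calc (∑ p, ∑ q, ind C p * ind A q * ind B q * (if TotDist p q = true then (1:ℤ) else 0))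
      = ∑ x : Pd d × Pd d, ind C x.1 * ind A x.2 * ind B x.2 * (if TotDist x.1 x.2 = true then (1:ℤ) else 0) :=
        (Fintype.sum_prod_type' (fun p q : Pd d => ind C p * ind A q * ind B q *
          (if TotDist p q = true then (1:ℤ) else 0))).symm
    _ = ∑ x : Pd d × Pd d, ind B (e x).1 * ind C (e x).2 * ind A (thirdPt (e x).1 (e x).2) *
          (if TotDist (e x).1 (e x).2 = true then (1:ℤ) else 0) := Fintype.sum_congr _ _ fun x => pt x.1 x.2
    _ = ∑ x : Pd d × Pd d, ind B x.1 * ind C x.2 * ind A (thirdPt x.1 x.2) * (if TotDist x.1 x.2 = true then (1:ℤ) else 0) :=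
        Equiv.sum_comp e (fun x : Pd d × Pd d => ind B x.1 * ind C x.2 * ind A (thirdPt x.1 x.2) *
          (if TotDist x.1 x.2 = true then (1:ℤ) else 0))
    _ = ∑ q, ∑ r, ind B q * ind C r * ind A (thirdPt q r) * (if TotDist q r = true then (1:ℤ) else 0) :=
        Fintype.sum_prod_type' (fun q r : Pd d => ind B q * ind C r * ind A (thirdPt q r) *
          (if TotDist q r = true then (1:ℤ) else 0))

/-! ### Second involution: the coordinate swap on a block -/

/-- **`N(A;B,C) = 2^d·|A ∩ B ∩ C|`** (every `d`, no monotonicity): if membership in `A` depends only on the axes in `I`, membership in `B` only on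
the axes outside `I`, and membership in `C` is unchanged when the `I`-coordinates of a point of `B` are altered, then the number of totally distinct
pairs `(p, q)` with `p ∈ A`, `q ∈ B ∩ C` equals `2^d` times `|A ∩ B ∩ C|` — the coordinate swap `(p, q) ↦ ((p on I, q off I), (q on I, p off I))`
is a value-preserving involution onto the pairs `(q', p')`, `q' ∈ A ∩ B ∩ C`, `p'` totally distinct from `q'`. [this work] -/
theorem sum_td_meet_eq_pow_mul_diag (I : Finset (Fin d)) {A B C : Finset (Pd d)}
    (hA : ∀ x y : Pd d, (∀ a ∈ I, x a = y a) → (x ∈ A ↔ y ∈ A))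
    (hB : ∀ x y : Pd d, (∀ a ∉ I, x a = y a) → (x ∈ B ↔ y ∈ B))
    (hC : ∀ x y : Pd d, (∀ a ∉ I, x a = y a) → x ∈ B → (x ∈ C ↔ y ∈ C)) :
    (∑ p, ∑ q, ind A p * ind B q * ind C q * (if TotDist p q = true then (1:ℤ) else 0)) =
      2 ^ d * ∑ p, ind A p * ind B p * ind C p := by
  classical
  let sw : Pd d → Pd d → Pd d := fun p q a => if a ∈ I then p a else q a
  have hsw : ∀ p q : Pd d, sw (sw p q) (sw q p) = p := fun p q => mix_mix I p q
  let e : Pd d × Pd d ≃ Pd d × Pd d :=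
    { toFun := fun x => (sw x.1 x.2, sw x.2 x.1)
      invFun := fun x => (sw x.1 x.2, sw x.2 x.1)
      left_inv := fun x => Prod.ext (hsw x.1 x.2) (hsw x.2 x.1)
      right_inv := fun x => Prod.ext (hsw x.1 x.2) (hsw x.2 x.1) }
  -- membership transport along the swap
  have swI : ∀ p q : Pd d, ∀ a ∈ I, sw p q a = p a := fun p q a ha => by
    show (if a ∈ I then p a else q a) = p a; rw [if_pos ha]
  have swO : ∀ p q : Pd d, ∀ a ∉ I, sw p q a = q a := fun p q a ha => by
    show (if a ∈ I then p a else q a) = q a; rw [if_neg ha]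
  have memA : ∀ p q : Pd d, p ∈ A ↔ sw p q ∈ A := fun p q => (hA (sw p q) p (swI p q)).symm
  have memB : ∀ p q : Pd d, q ∈ B ↔ sw p q ∈ B := fun p q => (hB (sw p q) q (swO p q)).symm
  have memC : ∀ p q : Pd d, q ∈ B → (q ∈ C ↔ sw p q ∈ C) := fun p q hq => hC q (sw p q) (fun a ha => (swO p q a ha).symm) hq
  have tdsw : ∀ p q : Pd d, TotDist p q = TotDist (sw p q) (sw q p) := by
    intro p q
    apply totDist_congr
    constructor
    · intro h a
      by_cases ha : a ∈ I
      · rw [swI p q a ha, swI q p a ha]; exact h a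
      · rw [swO p q a ha, swO q p a ha]; exact fun e => h a e.symm
    · intro h a
      have h1 := h a
      by_cases ha : a ∈ I
      · rw [swI p q a ha, swI q p a ha] at h1; exact h1
      · rw [swO p q a ha, swO q p a ha] at h1; exact fun e => h1 e.symm
  -- pointwise equality of the two summands along `e`
  have pt : ∀ p q : Pd d, ind A p * ind B q * ind C q * (if TotDist p q = true then (1:ℤ) else 0) =
      ind A (sw p q) * ind B (sw p q) * ind C (sw p q) * (if TotDist (sw p q) (sw q p) = true then (1:ℤ) else 0) := by
    intro p q
    by_cases hq : q ∈ B
    · rw [ind_congr_mem (memA p q), ind_congr_mem (memB p q), ind_congr_mem (memC p q hq), tdsw p q]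
    · have h0 : ind B q = 0 := if_neg hq
      have h0' : ind B (sw p q) = 0 := if_neg (fun h => hq ((memB p q).2 h))
      rw [h0, h0']; ring
  -- the diagonal side: `2^d` totally distinct partners per point
  have diag : (2:ℤ) ^ d * (∑ p, ind A p * ind B p * ind C p) =
      ∑ q, ∑ r, ind A q * ind B q * ind C q * (if TotDist q r = true then (1:ℤ) else 0) := by
    rw [Finset.mul_sum]
    refine Finset.sum_congr rfl fun q _ => ?_
    rw [← Finset.mul_sum]
    rw [sum_ite_totDist_eq_two_pow q]; ring
  rw [diag]
  calc (∑ p, ∑ q, ind A p * ind B q * ind C q * (if TotDist p q = true then (1:ℤ) else 0))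
      = ∑ x : Pd d × Pd d, ind A x.1 * ind B x.2 * ind C x.2 * (if TotDist x.1 x.2 = true then (1:ℤ) else 0) :=
        (Fintype.sum_prod_type' (fun p q : Pd d => ind A p * ind B q * ind C q *
          (if TotDist p q = true then (1:ℤ) else 0))).symm
    _ = ∑ x : Pd d × Pd d, ind A (e x).1 * ind B (e x).1 * ind C (e x).1 *
          (if TotDist (e x).1 (e x).2 = true then (1:ℤ) else 0) := Fintype.sum_congr _ _ fun x => pt x.1 x.2
    _ = ∑ x : Pd d × Pd d, ind A x.1 * ind B x.1 * ind C x.1 * (if TotDist x.1 x.2 = true then (1:ℤ) else 0) :=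
        Equiv.sum_comp e (fun x : Pd d × Pd d => ind A x.1 * ind B x.1 * ind C x.1 *
          (if TotDist x.1 x.2 = true then (1:ℤ) else 0))
    _ = ∑ q, ∑ r, ind A q * ind B q * ind C q * (if TotDist q r = true then (1:ℤ) else 0) :=
        Fintype.sum_prod_type' (fun q r : Pd d => ind A q * ind B q * ind C q *
          (if TotDist q r = true then (1:ℤ) else 0))

/-! ### The theorem -/

/-- **THE PATTERN FUNCTIONAL VANISHES ON THE SATURATED INDEPENDENT-PAIR FAMILY, EVERY DIMENSION** (no monotonicity needed).  Let `I, J` be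
disjoint sets of axes, let membership in `A` depend only on the coordinates in `I`, membership in `B` only on the coordinates in `J`, and suppose
membership in `C` is unchanged (a) when the `I`-coordinates of a point of `B` are altered and (b) when the `J`-coordinates of a point of `A` are
altered.  Then `sStarD A B C = 0`. [this work] -/
theorem sStarD_eq_zero_of_indepSlots_saturated (I J : Finset (Fin d)) (hIJ : Disjoint I J) {A B C : Finset (Pd d)}
    (hA : ∀ x y : Pd d, (∀ a ∈ I, x a = y a) → (x ∈ A ↔ y ∈ A))
    (hB : ∀ x y : Pd d, (∀ a ∈ J, x a = y a) → (x ∈ B ↔ y ∈ B))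
    (hCa : ∀ x y : Pd d, (∀ a ∉ I, x a = y a) → x ∈ B → (x ∈ C ↔ y ∈ C))
    (hCb : ∀ x y : Pd d, (∀ a ∉ J, x a = y a) → x ∈ A → (x ∈ C ↔ y ∈ C)) :
    sStarD A B C = 0 := by
  -- block measurability in the complementary form
  have hB' : ∀ x y : Pd d, (∀ a ∉ I, x a = y a) → (x ∈ B ↔ y ∈ B) := fun x y h =>
    hB x y fun a ha => h a (fun haI => Finset.disjoint_left.1 hIJ haI ha)
  have hA' : ∀ x y : Pd d, (∀ a ∉ J, x a = y a) → (x ∈ A ↔ y ∈ A) := fun x y h =>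
    hA x y fun a ha => h a (fun haJ => Finset.disjoint_left.1 hIJ ha haJ)
  -- the three identities
  have H1 := sum_td_meet_eq_pow_mul_diag I hA hB' hCa
  have H2 := sum_td_meet_eq_pow_mul_diag J hB hA' hCb
  have H3 := sum_td_meet_eq_latin I C hA hB'
  have e2 : (∑ p, ∑ q, ind B p * ind A q * ind C q * (if TotDist p q = true then (1:ℤ) else 0)) =
      2 ^ d * ∑ p, ind A p * ind B p * ind C p := by
    rw [H2]; exact congrArg _ (Finset.sum_congr rfl fun p _ => by ring)
  rw [sStarD_counting, H1, e2, H3]; ring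

/-! ### Corollaries: three classical zero families -/

/-- **Three mutually independent slots** (every `d`): if `A`, `B`, `C` are measurable with respect to pairwise disjoint sets of axes
`I`, `J`, `[d] ∖ (I ∪ J)`, then `sStarD A B C = 0`. [this work] -/
theorem sStarD_eq_zero_of_threeIndep (I J : Finset (Fin d)) (hIJ : Disjoint I J) {A B C : Finset (Pd d)}
    (hA : ∀ x y : Pd d, (∀ a ∈ I, x a = y a) → (x ∈ A ↔ y ∈ A))
    (hB : ∀ x y : Pd d, (∀ a ∈ J, x a = y a) → (x ∈ B ↔ y ∈ B))
    (hC : ∀ x y : Pd d, (∀ a, a ∉ I → a ∉ J → x a = y a) → (x ∈ C ↔ y ∈ C)) :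
    sStarD A B C = 0 :=
  sStarD_eq_zero_of_indepSlots_saturated I J hIJ hA hB
    (fun x y h _ => hC x y fun a haI _ => h a haI)
    (fun x y h _ => hC x y fun a _ haJ => h a haJ)

/-- **The 'coefficientwise zero' family** (every `d`): an independent pair `A` (`I`-measurable), `B` (`J`-measurable, `I ∩ J = ∅`) and ANY
`C ⊇ A ∪ B` give `sStarD A B C = 0`. [this work] -/
theorem sStarD_eq_zero_of_indep_union_subset (I J : Finset (Fin d)) (hIJ : Disjoint I J) {A B C : Finset (Pd d)}
    (hA : ∀ x y : Pd d, (∀ a ∈ I, x a = y a) → (x ∈ A ↔ y ∈ A))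
    (hB : ∀ x y : Pd d, (∀ a ∈ J, x a = y a) → (x ∈ B ↔ y ∈ B))
    (hAC : A ⊆ C) (hBC : B ⊆ C) : sStarD A B C = 0 := by
  refine sStarD_eq_zero_of_indepSlots_saturated I J hIJ hA hB (fun x y h hx => ?_) (fun x y h hx => ?_)
  · have hy : y ∈ B := (hB x y fun a ha => h a (fun haI => Finset.disjoint_left.1 hIJ haI ha)).1 hx
    exact ⟨fun _ => hBC hy, fun _ => hBC hx⟩
  · have hy : y ∈ A := (hA x y fun a ha => h a (fun haJ => Finset.disjoint_left.1 hIJ ha haJ)).1 hx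
    exact ⟨fun _ => hAC hy, fun _ => hAC hx⟩

/-- **The GATE family** (every `d`): an independent pair `A` (`I`-measurable), `B` (`J`-measurable, `I ∩ J = ∅`) and `C = X ∩ (A ∪ B)` with `X`
measurable with respect to the axes outside `I ∪ J` give `sStarD A B C = 0`. [this work] -/
theorem sStarD_eq_zero_of_gate (I J : Finset (Fin d)) (hIJ : Disjoint I J) {A B X : Finset (Pd d)}
    (hA : ∀ x y : Pd d, (∀ a ∈ I, x a = y a) → (x ∈ A ↔ y ∈ A))
    (hB : ∀ x y : Pd d, (∀ a ∈ J, x a = y a) → (x ∈ B ↔ y ∈ B))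
    (hX : ∀ x y : Pd d, (∀ a, a ∉ I → a ∉ J → x a = y a) → (x ∈ X ↔ y ∈ X)) :
    sStarD A B (X ∩ (A ∪ B)) = 0 := by
  refine sStarD_eq_zero_of_indepSlots_saturated I J hIJ hA hB (fun x y h hx => ?_) (fun x y h hx => ?_)
  · have hy : y ∈ B := (hB x y fun a ha => h a (fun haI => Finset.disjoint_left.1 hIJ haI ha)).1 hx
    have hXi : x ∈ X ↔ y ∈ X := hX x y fun a haI _ => h a haI
    simp only [Finset.mem_inter, Finset.mem_union]
    constructor
    · rintro ⟨h1, _⟩; exact ⟨hXi.1 h1, Or.inr hy⟩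
    · rintro ⟨h1, _⟩; exact ⟨hXi.2 h1, Or.inr hx⟩
  · have hy : y ∈ A := (hA x y fun a ha => h a (fun haJ => Finset.disjoint_left.1 hIJ ha haJ)).1 hx
    have hXi : x ∈ X ↔ y ∈ X := hX x y fun a _ haJ => h a haJ
    simp only [Finset.mem_inter, Finset.mem_union]
    constructor
    · rintro ⟨h1, _⟩; exact ⟨hXi.1 h1, Or.inl hy⟩
    · rintro ⟨h1, _⟩; exact ⟨hXi.2 h1, Or.inl hx⟩

/-! ### Appendix (generation 14, second landing): the exact two-slack formula for an independent pair -/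

/-- **THE PATTERN FUNCTIONAL OF AN INDEPENDENT PAIR IS THE SUM OF TWO COEFFICIENTWISE-HARRIS SLACKS** (every `d`, arbitrary `C`, no monotonicity):
if membership in `A` depends only on the axes in `I` and membership in `B` only on the axes outside `I`, then
`sStarD A B C = (2^d·|A∩B∩C| − N(A;B,C)) + (2^d·|A∩B∩C| − N(B;A,C))` — the Latin count `L(A;B,C)` cancels the third pair count `N(C;A,B)` EXACTLY
(`sum_td_meet_eq_latin`), refining the inequality proof of `sStarD_nonneg_of_indepSlots` (`…IndepSlots`).  For up-sets both brackets are `≥ 0`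
(coefficientwise Harris), and they vanish exactly under the saturation hypotheses of `sStarD_eq_zero_of_indepSlots_saturated`. [this work] -/
theorem sStarD_eq_two_harrisSlacks_of_indepSlots (I : Finset (Fin d)) {A B : Finset (Pd d)} (C : Finset (Pd d))
    (hA : ∀ x y : Pd d, (∀ a ∈ I, x a = y a) → (x ∈ A ↔ y ∈ A))
    (hB : ∀ x y : Pd d, (∀ a ∉ I, x a = y a) → (x ∈ B ↔ y ∈ B)) :
    sStarD A B C =
      (2 ^ d * (∑ p, ind A p * ind B p * ind C p) - (∑ p, ∑ q, ind A p * ind B q * ind C q * (if TotDist p q = true then (1:ℤ) else 0)))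
      + (2 ^ d * (∑ p, ind A p * ind B p * ind C p) - (∑ p, ∑ q, ind B p * ind A q * ind C q * (if TotDist p q = true then (1:ℤ) else 0))) := by
  rw [sStarD_counting, sum_td_meet_eq_latin I C hA hB]; ring

end Summit.CriticalPhenomena.PercolationContinuityZ3.Theorems.SahiGridPattern
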